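import Mathlib
import Summits.KontsevichZagierPeriods.Zeta5Search.Families.CubicalChartGeneral
import HarnessLib

/-!
# ζ(5) search — Families: integer-indexed coefficient extraction rules in the cubical chart (any number of gaps)

HONEST FRAMING: systematic search; no irrationality claim unless certified.  Cell `pub-zeta5`, certifier 2 (cert-2 g10,
2026-08-22).  Identities between integer coefficients of power series; nothing about `ζ(5)`; no number of record moves.

The bookkeeping companion of `Families/CubicalChartGeneral`: the coefficient `coeffZ c φ` of `x^c` for an INTEGER exponent
vector `c ∈ ℤ^N` (zero off the orthant) and the three rules that turn `[x^{M(B)}] (x^c · ∏ (1 − x^{v})^{A} · U(e))` into an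
explicit multiple binomial sum — Rule 1 `coeffZ_monomial_mul` (monomial shift), Rule 2 `coeffZ_oneSubPow_mul` (a binomial
factor `(1 − x^v)^A` becomes a free summation index weighted by `[y^k](1−y)^A`), Rule 3 `coeffZ_U` (the gap series contribute
`∏_i [y^{c_i}](1−y)^{e_i}`); and `monomial_symm_eq`.  (The six-gap versions live in `Families/CubicalChartLeadPi8v`.)
Standard axioms only.
-/

noncomputable section

open MvPowerSeries Finset

namespace Summit.KontsevichZagierPeriods.Zeta5Search.Families.Cellular

namespace CubicalChartN

open Summit.KontsevichZagierPeriods.Zeta5Search.Brown8 (coeffPow)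
open CubicalChart (coeffPow_of_idx_neg coeffPow_nat_nat)

variable {N : ℕ}

/-! ## Integer-indexed coefficients and the three extraction rules (general `N`) -/

/-- The coefficient of `x^c` for an INTEGER exponent vector `c` (`0` if some `c_i < 0`). -/
def coeffZ (c : Fin N → ℤ) (φ : T N) : ℤ :=
  if ∀ i, 0 ≤ c i then coeff (Finsupp.equivFunOnFinite.symm fun i => (c i).toNat) φ else 0

/-- At a natural exponent vector `coeffZ` is `coeff`. -/
theorem coeffZ_natCast (d : Fin N →₀ ℕ) (φ : T N) : coeffZ (fun i => (d i : ℤ)) φ = coeff d φ := by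
  unfold coeffZ
  rw [if_pos fun i => Int.natCast_nonneg _]
  congr 1; ext i; simp

/-- Additivity over finite sums. -/
theorem coeffZ_sum {ι : Type*} (s : Finset ι) (c : Fin N → ℤ) (φ : ι → T N) :
    coeffZ c (∑ k ∈ s, φ k) = ∑ k ∈ s, coeffZ c (φ k) := by
  unfold coeffZ
  split_ifs <;> simp [map_sum]

/-- Scalars. -/
theorem coeffZ_C_mul (c : Fin N → ℤ) (a : ℤ) (φ : T N) : coeffZ c (C a * φ) = a * coeffZ c φ := by
  unfold coeffZ
  by_cases h : ∀ i, 0 ≤ c i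
  · rw [if_pos h, if_pos h, MvPowerSeries.coeff_C_mul]
  · rw [if_neg h, if_neg h, mul_zero]

/-- **Rule 1 (monomial shift)**: `[x^c] (x^v · φ) = [x^{c − v}] φ`. -/
theorem coeffZ_monomial_mul (c : Fin N → ℤ) (v : Fin N →₀ ℕ) (φ : T N) :
    coeffZ c (monomial v 1 * φ) = coeffZ (fun i => c i - v i) φ := by
  unfold coeffZ
  by_cases h' : ∀ i, 0 ≤ c i - (v i : ℤ)
  · have h : ∀ i, 0 ≤ c i := fun i => by have := h' i; omega
    rw [if_pos h, if_pos h', coeff_monomial_mul]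
    have hv : v ≤ Finsupp.equivFunOnFinite.symm fun i => (c i).toNat := by
      intro i; simp only [Finsupp.coe_equivFunOnFinite_symm]; have := h' i; have := h i; omega
    rw [if_pos hv, one_mul]
    have hidx : (Finsupp.equivFunOnFinite.symm fun i => (c i).toNat) - v =
        Finsupp.equivFunOnFinite.symm fun i => (c i - (v i : ℤ)).toNat := by
      ext i
      simp only [Finsupp.coe_tsub, Pi.sub_apply, Finsupp.coe_equivFunOnFinite_symm]
      have := h i; have := h' i; omega
    rw [hidx]
  · rw [if_neg h']
    by_cases h : ∀ i, 0 ≤ c i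
    · rw [if_pos h, coeff_monomial_mul, if_neg]
      intro hv
      apply h'
      intro i
      have := hv i
      simp only [Finsupp.coe_equivFunOnFinite_symm] at this
      have := h i; omega
    · rw [if_neg h]

/-- **Rule 2 (binomial factor)**: `[x^c] ((1 − x^v)^A · φ) = Σ_{k=0}^{A} [y^k](1−y)^A · [x^{c − k v}] φ`. -/
theorem coeffZ_oneSubPow_mul (c : Fin N → ℤ) (v : Fin N →₀ ℕ) (A : ℕ) (φ : T N) :
    coeffZ c ((1 - monomial v 1) ^ A * φ) =
      ∑ k ∈ range (A + 1), coeffPow A k * coeffZ (fun i => c i - k * v i) φ := by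
  have hbin : ((1 : T N) - monomial v 1) ^ A =
      ∑ k ∈ range (A + 1), C ((-1) ^ k * (Nat.choose A k : ℤ)) * monomial (k • v) 1 := by
    rw [sub_eq_neg_add, add_pow]
    refine Finset.sum_congr rfl fun k _ => ?_
    rw [one_pow, mul_one, neg_pow, monomial_pow, one_pow, map_mul (C : ℤ →+* T N), map_pow (C : ℤ →+* T N),
      map_neg (C : ℤ →+* T N), map_one (C : ℤ →+* T N), map_natCast (C : ℤ →+* T N)]
    ring
  rw [hbin, Finset.sum_mul, coeffZ_sum]
  refine Finset.sum_congr rfl fun k _ => ?_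
  rw [mul_assoc, coeffZ_C_mul, coeffZ_monomial_mul, coeffPow_nat_nat]
  rfl

/-- **Rule 3 (the series)**: `[x^c] U(e) = ∏_i [y^{c_i}](1−y)^{e_i}` (zero off the orthant on both sides). -/
theorem coeffZ_U (c : Fin N → ℤ) (e : Fin N → ℤ) : coeffZ c (U e) = ∏ i, coeffPow (e i) (c i) := by
  unfold coeffZ
  by_cases h : ∀ i, 0 ≤ c i
  · rw [if_pos h, coeff_U]
    refine Finset.prod_congr rfl fun i _ => ?_
    congr 1; simp only [Finsupp.coe_equivFunOnFinite_symm]; have := h i; omega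
  · rw [if_neg h]
    obtain ⟨i, hi⟩ : ∃ i, c i < 0 := by
      by_contra h'; push Not at h'; exact h h'
    exact (Finset.prod_eq_zero (Finset.mem_univ i) (coeffPow_of_idx_neg _ _ hi)).symm

/-- A monomial with exponent vector given as a function is the product of the powers of the variables. -/
theorem monomial_symm_eq (f : Fin N → ℕ) :
    (monomial (Finsupp.equivFunOnFinite.symm f) (1 : ℤ) : T N) = ∏ k, x k ^ f k := by
  rw [MvPowerSeries.monomial_one_eq, Finsupp.prod_fintype _ _ (fun i => by simp)]
  simp

end CubicalChartN

end Summit.KontsevichZagierPeriods.Zeta5Search.Families.Cellular
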